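import Summits.QuantumAdvantage.QuantumAdvantage.Theses.RingFrame
import Summits.QuantumAdvantage.QuantumAdvantage.Theorems.RingFrameBeta
import Summits.QuantumAdvantage.QuantumAdvantage.Theorems.RingFrameBridge
import Summits.QuantumAdvantage.AdviceFreeQNC0.WalkCoreChain
import HarnessLib

/-!
# Route RingFrame, crux α `RingToElim` (stmt-QuantumAdvantage-19119): the crux from the walk core

Support theorems for the crux item (planner qa-qnc0-p1 Sketch10 §22.2, ask P9): the cell topic now
proves, in the kernel, the equivalence of four formulations of walk-game hardness at polylog degree —
`WalkHardAll ↔ MixedHardPolylog ↔ LDMAWalk ↔ LDMAFam` (`WalkCoreHub.lean`, `WalkCoreMixed.lean`,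
`WalkCoreChain.lean`).  Composed with the route's transport `ringHard_two_of_walkHard`
(`WalkTransport.lean`, charge `n + 2`), EACH of them implies the single-charge hypothesis `RingHardU`
of line `product` and hence the route crux
`Summit.QuantumAdvantage.QuantumAdvantage.Theses.RingFrame.RingToElim` (whose hypothesis `ElimHard`
is not even used: the transport gives `RingHard 2` outright), and — with the closed items β / bridge
of the route — the separation `AdviceFreeQNC0`.

* `ringHardU_of_walkHardAll` (Sketch10 `RingHardUOfWalkHardAll`), `ringToElim_of_walkHardAll`,
  `ringToElim_of_mixedHardPolylog`, `ringToElim_of_ldmaWalk`, `ringToElim_of_ldmaFam`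
  (Sketch10 `LDMAFamClosesCrux`), `adviceFreeQNC0_of_walkHardAll`.

WHAT THIS IS NOT: not a proof of the crux — `WalkHardAll` (≡ the other three) is OPEN; the converse
`RingHardU → WalkHardAll` (E6, charge propagation) is not here.
-/

-- the sub-problem namespace `Summit.QuantumAdvantage.QuantumAdvantage` repeats the summit name by design (D-0017)
set_option linter.dupNamespace false

namespace Summit.QuantumAdvantage.QuantumAdvantage.Theorems

open Finset Summit.QuantumAdvantage.AdviceFreeQNC0
open Literature.Computability.MetaComplexity Literature.Computability.MetaComplexity.Smolensky

/-- **`WalkHardAll → RingHardU`** (the charge `c = n + 2`; Sketch10 `RingHardUOfWalkHardAll`; the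
conclusion is the body of `RingToElim.RingHardU` of `RingFrameRingToElimDefs.lean`, verbatim). -/
theorem ringHardU_of_walkHardAll (h : WalkHardAll) :
    ∃ θ : ℝ, θ < 1 ∧ ∀ C : ℕ, ∃ n₀ : ℕ, ∀ n ≥ n₀, ∀ y : Fin (n + 1) → (Fin n → Bool) → Bool,
      (∀ g, HasDeg (y g) ((Nat.log 2 n) ^ C)) →
        ((univ.filter fun u : Fin n → Bool => ringWinU (n + 2) y u = true).card : ℝ) ≤
          θ * (2 : ℝ) ^ n := by
  obtain ⟨θ, hθ, hW⟩ := h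
  refine ⟨θ, hθ, fun C => ?_⟩
  obtain ⟨n₀, hn₀⟩ := hW C
  exact ⟨n₀, fun n hn y hy => hn₀ n hn (n + 2) y hy⟩

/-- **Crux α from `WalkHardAll`.** -/
theorem ringToElim_of_walkHardAll (h : WalkHardAll) :
    Summit.QuantumAdvantage.QuantumAdvantage.Theses.RingFrame.RingToElim :=
  fun _ => ringHard_two_of_walkHard (ringHardU_of_walkHardAll h)

/-- **Crux α from `MixedHardPolylog`** (prover-3's mixed game at polylog degree; the hub). -/
theorem ringToElim_of_mixedHardPolylog (h : MixedHardPolylog) :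
    Summit.QuantumAdvantage.QuantumAdvantage.Theses.RingFrame.RingToElim :=
  ringToElim_of_walkHardAll (mixedHardPolylog_iff_walkHardAll.1 h)

/-- **Crux α from `LDMAWalk`** (LDMA restricted to walk rows). -/
theorem ringToElim_of_ldmaWalk (h : LDMAWalk) :
    Summit.QuantumAdvantage.QuantumAdvantage.Theses.RingFrame.RingToElim :=
  ringToElim_of_walkHardAll (walkHardAll_of_ldmaWalk h)

/-- **Crux α from `LDMAFam`** (Sketch10 `LDMAFamClosesCrux`; W2). -/
theorem ringToElim_of_ldmaFam (h : LDMAFam) :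
    Summit.QuantumAdvantage.QuantumAdvantage.Theses.RingFrame.RingToElim :=
  ringToElim_of_walkHardAll (ldmaFam_suffices h)

/-- **The rung leaf from `WalkHardAll`**: with the route's closed items (β side, the bridge) the whole
route reduces to walk-game hardness at all charges and polylog degree. -/
theorem adviceFreeQNC0_of_walkHardAll (h : WalkHardAll) :
    Summit.QuantumAdvantage.AdviceFreeQNC0.AdviceFreeQNC0 :=
  Summit.QuantumAdvantage.QuantumAdvantage.Theses.RingFrame.closes (ringToElim_of_walkHardAll h)
    ringFrame_lowDegAvoidOfRobustHegedus ringFrame_robustHegedusFact ringFrame_elimSqrtOfSparse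
    ringFrame_elimHardOfSqrt bridgeRingToSep_proof

end Summit.QuantumAdvantage.QuantumAdvantage.Theorems
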